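import Literature.Geometry.Kaehler.ComplexTorusHodgeGroupProductLieAlgebraGoursat
import Literature.Geometry.Kaehler.ComplexTorusHodgeLieAlgebraNoTypeFourSemisimple
import HarnessLib

/-!
# `Hg(X₁ × X₂) = Hg(X₁) × Hg(X₂)` for polarised complex tori whose complex Hodge Lie algebras `𝔥𝔤_ℂ(X₁)`, `𝔥𝔤_ℂ(X₂)` share no
# ideal (Moonen–Zarhin (3.1): `𝔤₃ = 0`); the no-type-IV ∕ `End_ℚ = ℚ` forms, the (D)-transfer, and the dimension formula
# `dim 𝔥𝔤(X₁ × X₂) + dim 𝔤₃ = dim 𝔥𝔤(X₁) + dim 𝔥𝔤(X₂)`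

Layer `Literature/Geometry/Kaehler`, namespace `Literature.Geometry.Kaehler.ComplexTorus`; lane `lit-hodgefound` (Track 2
foundations library), Layer A3/A4; prover seat `lit-hodgefound-p17` (generation 40, self-proposed row g40-#8, the sequel of g40-#7
`ComplexTorusHodgeGroupProductLieAlgebraGoursat` — there for arbitrary tori in the vocabulary `lieSubalgebraGL (Hg(Xᵢ)(ℂ))`; here in
the ANALYTIC vocabulary `𝔥𝔤_ℂ(X) = hodgeGroupComplexLie Φ` (equal to it, `hodgeGroupComplexLie_eq_lieSubalgebraGL`), fed with the
tree's arithmetic inputs: `𝔥𝔤_ℂ(X)` is REDUCTIVE for a polarised torus (p40's `IsRiemannForm.hasCentralRadical_hodgeGroupComplexLie`,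
Deligne I 3.6) and SEMISIMPLE when the Rosati involution fixes the centre of `End_ℚ(X)` ("no factors of type IV",
`IsRiemannForm.isSemisimple_hodgeGroupComplexLie_of_forall_rosati_eq`) or `End_ℚ(X) = ℚ`).  THEOREMS ONLY (no definition, no
instance, no notation, no named fact; D-0026 net debt 0).

MOONEN–ZARHIN (3.1) (held `paper:arxiv-math_9901113` p0006 L24–L60): «there exist Lie algebras `𝔤₁`, `𝔤₂`, `𝔤₃` and an
automorphism `φ` of `𝔤₃` such that `𝔥𝔤(X₁) ≅ 𝔤₁ ⊕ 𝔤₃`, `𝔥𝔤(X₂) ≅ 𝔤₂ ⊕ 𝔤₃`, and `𝔥𝔤(X₁ × X₂) ≅ 𝔤₁ ⊕ 𝔤₂ ⊕ Γ_φ` […] We may have that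
`Hg(X₁ × X₂) ≠ Hg(X₁) × Hg(X₂)`. (I.e., `𝔤₃ ≠ 0` in the above.)»; Theorem (3.2)(1): «Suppose `X₁` and `X₂` contain no factors of
Type 4 [and both satisfy (D)]. Then `X₁ × X₂` again satisfies (D)» — here in the special case where the complexified Hodge Lie
algebras share no simple factor (the general no-type-IV case needs Hazama's invariant theory and stays the named fact
`Hazama1989_stablyNondegenerate_prod` of `StablyNondegenerateProducts`).

## What is proved

* §1 (arbitrary tori, hypotheses on `𝔥𝔤_ℂ(Xᵢ)`): `hodgeGroupC_prod_eq_blockDiagProd_of_forall_isSimple_isEmpty_lieEquiv_hodgeGroupComplexLie`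
  (semisimple, no common simple factor), `hodgeGroupC_prod_eq_blockDiagProd_of_forall_ne_bot_isEmpty_lieEquiv_hodgeGroupComplexLie`
  (reductive, no common non-zero ideal).
* §2 (POLARISED tori): **`IsRiemannForm.hodgeGroupC_prod_eq_blockDiagProd_of_forall_ne_bot_isEmpty_lieEquiv`** — `X₁`, `X₂` polarised
  and no non-zero ideal of `𝔥𝔤_ℂ(X₁)` is isomorphic to an ideal of `𝔥𝔤_ℂ(X₂)` ⟹ `Hg(X₁ × X₂)(ℂ) = Hg(X₁)(ℂ) × Hg(X₂)(ℂ)` ("`𝔤₃ = 0`"),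
  its real points and `IsAbelianVariety` forms; **`IsRiemannForm.hodgeGroupC_prod_eq_blockDiagProd_of_forall_rosati_eq_of_forall_isSimple_isEmpty_lieEquiv`**
  (no type IV on both sides + no common SIMPLE factor) and `IsRiemannForm.…_of_endAlgRat_eq_bot_…` (`End_ℚ(Xᵢ) = ℚ`).
* §3 (D)-TRANSFER: **`IsRiemannForm.forall_divisorClasses_powPeriod_prod_eq_hodgeClasses_of_forall_ne_bot_isEmpty_lieEquiv`** — polarised,
  stably nondegenerate `X₁`, `X₂` whose `𝔥𝔤_ℂ` share no non-zero ideal have a stably nondegenerate product; the no-type-IV form.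
* §4 THE `𝔤₃` DIMENSION FORMULA: **`IsRiemannForm.exists_lieIdeal_lieEquiv_finrank_add_eq`** — for polarised `X₁`, `X₂` there are ideals
  `C₁ ⊆ 𝔥𝔤_ℂ(X₁)`, `C₂ ⊆ 𝔥𝔤_ℂ(X₂)` (`≅ 𝔤₃`), `C₁ ≃ₗ⁅ℂ⁆ C₂`, with `dim 𝔥𝔤_ℂ(X₁ × X₂) + dim C₁ = dim 𝔥𝔤_ℂ(X₁) + dim 𝔥𝔤_ℂ(X₂)`.

## References

* [MoonenZarhin1999LowDim] B. Moonen, Yu. G. Zarhin, Math. Ann. 315 (1999), §3 (3.1), Thm. (3.2)(1), §1 ("no factors of Type 4 ⟹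
  `Hg(X)` semi-simple").
* [Gordon1997] B. B. Gordon, *A survey of the Hodge conjecture for abelian varieties* (alg-geom/9709030), §2.16 Proposition, Thm. 7.6.2.
* [Hazama1983] F. Hazama, Tôhoku Math. J. 35 (1983), Lemma (3.1).
* [Deligne1982HodgeCycles] P. Deligne, *Hodge cycles on abelian varieties*, LNM 900 (1982), I Prop. 3.6.
-/

noncomputable section

open Matrix Module

namespace Literature.Geometry.Kaehler

namespace ComplexTorus

open Literature.NumberTheory.Automorphic (lieAlgebraGL lieSubalgebraGL)
open Literature.Algebra.Lie

variable {ι₁ ι₂ : Type*} [Fintype ι₁] [Fintype ι₂] [DecidableEq ι₁] [DecidableEq ι₂]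
  {E₁ E₂ : Type*} [NormedAddCommGroup E₁] [NormedSpace ℂ E₁] [NormedAddCommGroup E₂] [NormedSpace ℂ E₂]
  (Φ₁ : (ι₁ → ℝ) ≃L[ℝ] E₁) (Φ₂ : (ι₂ → ℝ) ≃L[ℝ] E₂)

/-! ### §1 Hypotheses on the analytic complex Hodge Lie algebras `𝔥𝔤_ℂ(Xᵢ)` -/

/-- **`𝔥𝔤_ℂ(X₁)`, `𝔥𝔤_ℂ(X₂)` semisimple with no common simple factor ⟹ `Hg(X₁ × X₂)(ℂ) = Hg(X₁)(ℂ) × Hg(X₂)(ℂ)`** (g40-#7 through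
`hodgeGroupComplexLie_eq_lieSubalgebraGL`). [cite: MoonenZarhin1999LowDim, §3 (3.1)] [cite: Gordon1997, §2.16 Proposition] -/
theorem hodgeGroupC_prod_eq_blockDiagProd_of_forall_isSimple_isEmpty_lieEquiv_hodgeGroupComplexLie
    [h₁ : LieAlgebra.IsSemisimple ℂ (hodgeGroupComplexLie Φ₁)] [h₂ : LieAlgebra.IsSemisimple ℂ (hodgeGroupComplexLie Φ₂)]
    (h : ∀ (A : LieIdeal ℂ (hodgeGroupComplexLie Φ₁)) (B : LieIdeal ℂ (hodgeGroupComplexLie Φ₂)),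
      LieAlgebra.IsSimple ℂ A → LieAlgebra.IsSimple ℂ B → IsEmpty (A ≃ₗ⁅ℂ⁆ B)) :
    hodgeGroupC (prodPeriod Φ₁ Φ₂) = blockDiagProd (hodgeGroupC Φ₁) (hodgeGroupC Φ₂) := by
  rw [hodgeGroupComplexLie_eq_lieSubalgebraGL Φ₁] at h₁ h
  rw [hodgeGroupComplexLie_eq_lieSubalgebraGL Φ₂] at h₂ h
  exact hodgeGroupC_prod_eq_blockDiagProd_of_forall_isSimple_isEmpty_lieEquiv Φ₁ Φ₂ h

/-- **`𝔥𝔤_ℂ(X₁)`, `𝔥𝔤_ℂ(X₂)` reductive with no non-zero ideal of one isomorphic to an ideal of the other ⟹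
`Hg(X₁ × X₂)(ℂ) = Hg(X₁)(ℂ) × Hg(X₂)(ℂ)`.** [cite: MoonenZarhin1999LowDim, §3 (3.1)] [cite: Gordon1997, §2.16 Proposition] -/
theorem hodgeGroupC_prod_eq_blockDiagProd_of_forall_ne_bot_isEmpty_lieEquiv_hodgeGroupComplexLie
    [h₁ : LieAlgebra.HasCentralRadical ℂ (hodgeGroupComplexLie Φ₁)] [h₂ : LieAlgebra.HasCentralRadical ℂ (hodgeGroupComplexLie Φ₂)]
    (h : ∀ I : LieIdeal ℂ (hodgeGroupComplexLie Φ₁), I ≠ ⊥ → ∀ J : LieIdeal ℂ (hodgeGroupComplexLie Φ₂), IsEmpty (I ≃ₗ⁅ℂ⁆ J)) :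
    hodgeGroupC (prodPeriod Φ₁ Φ₂) = blockDiagProd (hodgeGroupC Φ₁) (hodgeGroupC Φ₂) := by
  rw [hodgeGroupComplexLie_eq_lieSubalgebraGL Φ₁] at h₁ h
  rw [hodgeGroupComplexLie_eq_lieSubalgebraGL Φ₂] at h₂ h
  exact hodgeGroupC_prod_eq_blockDiagProd_of_forall_ne_bot_isEmpty_lieEquiv Φ₁ Φ₂ h

/-! ### §2 Polarised tori: `𝔥𝔤_ℂ` is reductive (Deligne I 3.6), semisimple without type IV -/

/-- **MOONEN–ZARHIN (3.1), "`𝔤₃ = 0`" CASE: for POLARISED complex tori `X₁`, `X₂` such that no non-zero ideal of `𝔥𝔤_ℂ(X₁)` is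
isomorphic (as a complex Lie algebra) to an ideal of `𝔥𝔤_ℂ(X₂)`, `Hg(X₁ × X₂)(ℂ) = Hg(X₁)(ℂ) × Hg(X₂)(ℂ)`** (the `𝔥𝔤_ℂ(Xᵢ)` are
reductive, so every ideal is a direct factor and Goursat's common factor `𝔤₃ ≅ C₁ ≅ C₂` would be such an ideal).
[cite: MoonenZarhin1999LowDim, §3 (3.1)] [cite: Deligne1982HodgeCycles, I Prop. 3.6] [cite: Gordon1997, §2.16 Proposition] -/
theorem IsRiemannForm.hodgeGroupC_prod_eq_blockDiagProd_of_forall_ne_bot_isEmpty_lieEquiv {η₁ : E₁ [⋀^Fin 2]→L[ℝ] ℝ}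
    {η₂ : E₂ [⋀^Fin 2]→L[ℝ] ℝ} (hη₁ : IsRiemannForm Φ₁ η₁) (hη₂ : IsRiemannForm Φ₂ η₂)
    (h : ∀ I : LieIdeal ℂ (hodgeGroupComplexLie Φ₁), I ≠ ⊥ → ∀ J : LieIdeal ℂ (hodgeGroupComplexLie Φ₂), IsEmpty (I ≃ₗ⁅ℂ⁆ J)) :
    hodgeGroupC (prodPeriod Φ₁ Φ₂) = blockDiagProd (hodgeGroupC Φ₁) (hodgeGroupC Φ₂) := by
  haveI := hη₁.hasCentralRadical_hodgeGroupComplexLie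
  haveI := hη₂.hasCentralRadical_hodgeGroupComplexLie
  exact hodgeGroupC_prod_eq_blockDiagProd_of_forall_ne_bot_isEmpty_lieEquiv_hodgeGroupComplexLie Φ₁ Φ₂ h

/-- Real points: polarised `X₁`, `X₂` with no common non-zero ideal of `𝔥𝔤_ℂ` ⟹ `Hg(X₁ × X₂)(ℝ) = Hg(X₁)(ℝ) × Hg(X₂)(ℝ)`.
[cite: MoonenZarhin1999LowDim, §3 (3.1)] -/
theorem IsRiemannForm.hodgeGroup_prod_eq_of_forall_ne_bot_isEmpty_lieEquiv {η₁ : E₁ [⋀^Fin 2]→L[ℝ] ℝ}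
    {η₂ : E₂ [⋀^Fin 2]→L[ℝ] ℝ} (hη₁ : IsRiemannForm Φ₁ η₁) (hη₂ : IsRiemannForm Φ₂ η₂)
    (h : ∀ I : LieIdeal ℂ (hodgeGroupComplexLie Φ₁), I ≠ ⊥ → ∀ J : LieIdeal ℂ (hodgeGroupComplexLie Φ₂), IsEmpty (I ≃ₗ⁅ℂ⁆ J)) :
    hodgeGroup (prodPeriod Φ₁ Φ₂) = ((hodgeGroup Φ₁).prod (hodgeGroup Φ₂)).map (blockDiag ι₁ ι₂) :=
  hodgeGroup_prod_eq_of_hodgeGroupC_prod_eq (hη₁.hodgeGroupC_prod_eq_blockDiagProd_of_forall_ne_bot_isEmpty_lieEquiv Φ₁ Φ₂ hη₂ h)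

/-- Abelian varieties `X₁`, `X₂` with no common non-zero ideal of `𝔥𝔤_ℂ` ⟹ `Hg(X₁ × X₂)(ℂ) = Hg(X₁)(ℂ) × Hg(X₂)(ℂ)`.
[cite: MoonenZarhin1999LowDim, §3 (3.1)] [cite: Deligne1982HodgeCycles, I Prop. 3.6] -/
theorem IsAbelianVariety.hodgeGroupC_prod_eq_blockDiagProd_of_forall_ne_bot_isEmpty_lieEquiv (hX₁ : IsAbelianVariety Φ₁)
    (hX₂ : IsAbelianVariety Φ₂)
    (h : ∀ I : LieIdeal ℂ (hodgeGroupComplexLie Φ₁), I ≠ ⊥ → ∀ J : LieIdeal ℂ (hodgeGroupComplexLie Φ₂), IsEmpty (I ≃ₗ⁅ℂ⁆ J)) :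
    hodgeGroupC (prodPeriod Φ₁ Φ₂) = blockDiagProd (hodgeGroupC Φ₁) (hodgeGroupC Φ₂) := by
  haveI := hX₁.hasCentralRadical_hodgeGroupComplexLie
  haveI := hX₂.hasCentralRadical_hodgeGroupComplexLie
  exact hodgeGroupC_prod_eq_blockDiagProd_of_forall_ne_bot_isEmpty_lieEquiv_hodgeGroupComplexLie Φ₁ Φ₂ h

/-- **NO FACTORS OF TYPE IV on both sides (the Rosati involutions fix the centres of `End_ℚ(Xᵢ)`) and no common SIMPLE factor of
`𝔥𝔤_ℂ(X₁)`, `𝔥𝔤_ℂ(X₂)` ⟹ `Hg(X₁ × X₂)(ℂ) = Hg(X₁)(ℂ) × Hg(X₂)(ℂ)`** (Moonen–Zarhin §1: then `𝔥𝔤(Xᵢ)` is semisimple).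
[cite: MoonenZarhin1999LowDim, §1 and §3 (3.1)] [cite: Gordon1997, §2.16 Proposition] -/
theorem IsRiemannForm.hodgeGroupC_prod_eq_blockDiagProd_of_forall_rosati_eq_of_forall_isSimple_isEmpty_lieEquiv
    {η₁ : E₁ [⋀^Fin 2]→L[ℝ] ℝ} {η₂ : E₂ [⋀^Fin 2]→L[ℝ] ℝ} (hη₁ : IsRiemannForm Φ₁ η₁) (hη₂ : IsRiemannForm Φ₂ η₂)
    {G₁ : Matrix ι₁ ι₁ ℚ} (hG₁ : G₁.map (Rat.cast : ℚ → ℝ) = latticeGram Φ₁ η₁)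
    (htriv₁ : ∀ B ∈ endAlgRat Φ₁, (∀ C ∈ endAlgRat Φ₁, B * C = C * B) → rosati G₁ B = B)
    {G₂ : Matrix ι₂ ι₂ ℚ} (hG₂ : G₂.map (Rat.cast : ℚ → ℝ) = latticeGram Φ₂ η₂)
    (htriv₂ : ∀ B ∈ endAlgRat Φ₂, (∀ C ∈ endAlgRat Φ₂, B * C = C * B) → rosati G₂ B = B)
    (h : ∀ (A : LieIdeal ℂ (hodgeGroupComplexLie Φ₁)) (B : LieIdeal ℂ (hodgeGroupComplexLie Φ₂)),
      LieAlgebra.IsSimple ℂ A → LieAlgebra.IsSimple ℂ B → IsEmpty (A ≃ₗ⁅ℂ⁆ B)) :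
    hodgeGroupC (prodPeriod Φ₁ Φ₂) = blockDiagProd (hodgeGroupC Φ₁) (hodgeGroupC Φ₂) := by
  haveI := hη₁.isSemisimple_hodgeGroupComplexLie_of_forall_rosati_eq hG₁ htriv₁
  haveI := hη₂.isSemisimple_hodgeGroupComplexLie_of_forall_rosati_eq hG₂ htriv₂
  exact hodgeGroupC_prod_eq_blockDiagProd_of_forall_isSimple_isEmpty_lieEquiv_hodgeGroupComplexLie Φ₁ Φ₂ h

/-- **`End_ℚ(X₁) = ℚ = End_ℚ(X₂)` (polarised) and no common simple factor of `𝔥𝔤_ℂ(X₁)`, `𝔥𝔤_ℂ(X₂)` ⟹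
`Hg(X₁ × X₂)(ℂ) = Hg(X₁)(ℂ) × Hg(X₂)(ℂ)`.** [cite: MoonenZarhin1999LowDim, §1 and §3 (3.1)] [cite: Gordon1997, §2.16 Proposition] -/
theorem IsRiemannForm.hodgeGroupC_prod_eq_blockDiagProd_of_endAlgRat_eq_bot_of_forall_isSimple_isEmpty_lieEquiv
    {η₁ : E₁ [⋀^Fin 2]→L[ℝ] ℝ} {η₂ : E₂ [⋀^Fin 2]→L[ℝ] ℝ} (hη₁ : IsRiemannForm Φ₁ η₁) (hη₂ : IsRiemannForm Φ₂ η₂)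
    (hE₁ : endAlgRat Φ₁ = ⊥) (hE₂ : endAlgRat Φ₂ = ⊥)
    (h : ∀ (A : LieIdeal ℂ (hodgeGroupComplexLie Φ₁)) (B : LieIdeal ℂ (hodgeGroupComplexLie Φ₂)),
      LieAlgebra.IsSimple ℂ A → LieAlgebra.IsSimple ℂ B → IsEmpty (A ≃ₗ⁅ℂ⁆ B)) :
    hodgeGroupC (prodPeriod Φ₁ Φ₂) = blockDiagProd (hodgeGroupC Φ₁) (hodgeGroupC Φ₂) := by
  haveI := hη₁.isSemisimple_hodgeGroupComplexLie_of_endAlgRat_eq_bot hE₁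
  haveI := hη₂.isSemisimple_hodgeGroupComplexLie_of_endAlgRat_eq_bot hE₂
  exact hodgeGroupC_prod_eq_blockDiagProd_of_forall_isSimple_isEmpty_lieEquiv_hodgeGroupComplexLie Φ₁ Φ₂ h

/-! ### §3 The (D)-transfer -/

variable {Φ₁ Φ₂} in
/-- **(D)-TRANSFER (Moonen–Zarhin Thm. (3.2)(1), Lie-theoretic case): polarised, stably nondegenerate `X₁`, `X₂` whose `𝔥𝔤_ℂ` share
no non-zero ideal have a stably nondegenerate product `X₁ × X₂`** (all Hodge classes on all powers generated by divisor classes).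
[cite: MoonenZarhin1999LowDim, §3 (3.1) and Thm. (3.2)(1)] [cite: Gordon1997, Thm. 7.6.2] -/
theorem IsRiemannForm.forall_divisorClasses_powPeriod_prod_eq_hodgeClasses_of_forall_ne_bot_isEmpty_lieEquiv
    {η₁ : E₁ [⋀^Fin 2]→L[ℝ] ℝ} {η₂ : E₂ [⋀^Fin 2]→L[ℝ] ℝ} (hη₁ : IsRiemannForm Φ₁ η₁) (hη₂ : IsRiemannForm Φ₂ η₂)
    (h : ∀ I : LieIdeal ℂ (hodgeGroupComplexLie Φ₁), I ≠ ⊥ → ∀ J : LieIdeal ℂ (hodgeGroupComplexLie Φ₂), IsEmpty (I ≃ₗ⁅ℂ⁆ J))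
    (hX₁ : ∀ k p, divisorClasses (powPeriod Φ₁ k) p = hodgeClasses (powPeriod Φ₁ k) p)
    (hX₂ : ∀ k p, divisorClasses (powPeriod Φ₂ k) p = hodgeClasses (powPeriod Φ₂ k) p) :
    ∀ k p, divisorClasses (powPeriod (prodPeriod Φ₁ Φ₂) k) p = hodgeClasses (powPeriod (prodPeriod Φ₁ Φ₂) k) p :=
  forall_divisorClasses_powPeriod_prod_eq_hodgeClasses_of_hodgeGroupC_prod_eq
    (hη₁.hodgeGroupC_prod_eq_blockDiagProd_of_forall_ne_bot_isEmpty_lieEquiv Φ₁ Φ₂ hη₂ h) hX₁ hX₂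

variable {Φ₁ Φ₂} in
/-- (D)-transfer, no-type-IV form: polarised, stably nondegenerate `X₁`, `X₂` without factors of type IV and with no common simple
factor of `𝔥𝔤_ℂ(X₁)`, `𝔥𝔤_ℂ(X₂)` have a stably nondegenerate product. [cite: MoonenZarhin1999LowDim, Thm. (3.2)(1)] [cite: Gordon1997, Thm. 7.6.2] -/
theorem IsRiemannForm.forall_divisorClasses_powPeriod_prod_eq_hodgeClasses_of_forall_rosati_eq_of_forall_isSimple_isEmpty_lieEquiv
    {η₁ : E₁ [⋀^Fin 2]→L[ℝ] ℝ} {η₂ : E₂ [⋀^Fin 2]→L[ℝ] ℝ} (hη₁ : IsRiemannForm Φ₁ η₁) (hη₂ : IsRiemannForm Φ₂ η₂)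
    {G₁ : Matrix ι₁ ι₁ ℚ} (hG₁ : G₁.map (Rat.cast : ℚ → ℝ) = latticeGram Φ₁ η₁)
    (htriv₁ : ∀ B ∈ endAlgRat Φ₁, (∀ C ∈ endAlgRat Φ₁, B * C = C * B) → rosati G₁ B = B)
    {G₂ : Matrix ι₂ ι₂ ℚ} (hG₂ : G₂.map (Rat.cast : ℚ → ℝ) = latticeGram Φ₂ η₂)
    (htriv₂ : ∀ B ∈ endAlgRat Φ₂, (∀ C ∈ endAlgRat Φ₂, B * C = C * B) → rosati G₂ B = B)
    (h : ∀ (A : LieIdeal ℂ (hodgeGroupComplexLie Φ₁)) (B : LieIdeal ℂ (hodgeGroupComplexLie Φ₂)),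
      LieAlgebra.IsSimple ℂ A → LieAlgebra.IsSimple ℂ B → IsEmpty (A ≃ₗ⁅ℂ⁆ B))
    (hX₁ : ∀ k p, divisorClasses (powPeriod Φ₁ k) p = hodgeClasses (powPeriod Φ₁ k) p)
    (hX₂ : ∀ k p, divisorClasses (powPeriod Φ₂ k) p = hodgeClasses (powPeriod Φ₂ k) p) :
    ∀ k p, divisorClasses (powPeriod (prodPeriod Φ₁ Φ₂) k) p = hodgeClasses (powPeriod (prodPeriod Φ₁ Φ₂) k) p :=
  forall_divisorClasses_powPeriod_prod_eq_hodgeClasses_of_hodgeGroupC_prod_eq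
    (hη₁.hodgeGroupC_prod_eq_blockDiagProd_of_forall_rosati_eq_of_forall_isSimple_isEmpty_lieEquiv Φ₁ Φ₂ hη₂ hG₁ htriv₁ hG₂
      htriv₂ h) hX₁ hX₂

/-! ### §4 Moonen–Zarhin's `𝔤₃`: `dim 𝔥𝔤(X₁ × X₂) + dim 𝔤₃ = dim 𝔥𝔤(X₁) + dim 𝔥𝔤(X₂)` -/

/-- **MOONEN–ZARHIN (3.1), DIMENSION FORM, for POLARISED tori: there are ideals `C₁ ⊆ 𝔥𝔤_ℂ(X₁)`, `C₂ ⊆ 𝔥𝔤_ℂ(X₂)` (both `≅ 𝔤₃`), isomorphic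
as complex Lie algebras, with `dim 𝔥𝔤_ℂ(X₁ × X₂) + dim C₁ = dim 𝔥𝔤_ℂ(X₁) + dim 𝔥𝔤_ℂ(X₂)`** (`𝔥𝔤_ℂ(X₁) = 𝔫₁ ⊕ C₁`, `𝔥𝔤_ℂ(X₂) = 𝔫₂ ⊕ C₂`,
`Cᵢ ≅ 𝔥𝔤_ℂ(Xᵢ) ⧸ 𝔫ᵢ`, Goursat; reductivity of `𝔥𝔤_ℂ` supplies the complements). [cite: MoonenZarhin1999LowDim, §3 (3.1)]
[cite: Deligne1982HodgeCycles, I Prop. 3.6] [cite: Hazama1983, Lemma (3.1)] -/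
theorem IsRiemannForm.exists_lieIdeal_lieEquiv_finrank_add_eq {η₁ : E₁ [⋀^Fin 2]→L[ℝ] ℝ} {η₂ : E₂ [⋀^Fin 2]→L[ℝ] ℝ}
    (hη₁ : IsRiemannForm Φ₁ η₁) (hη₂ : IsRiemannForm Φ₂ η₂) :
    ∃ (C₁ : LieIdeal ℂ (hodgeGroupComplexLie Φ₁)) (C₂ : LieIdeal ℂ (hodgeGroupComplexLie Φ₂)), Nonempty (C₁ ≃ₗ⁅ℂ⁆ C₂) ∧
      finrank ℂ (hodgeGroupComplexLie (prodPeriod Φ₁ Φ₂)) + finrank ℂ C₁ =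
        finrank ℂ (hodgeGroupComplexLie Φ₁) + finrank ℂ (hodgeGroupComplexLie Φ₂) := by
  have h₁ := hη₁.hasCentralRadical_hodgeGroupComplexLie
  have h₂ := hη₂.hasCentralRadical_hodgeGroupComplexLie
  rw [hodgeGroupComplexLie_eq_lieSubalgebraGL Φ₁] at h₁ ⊢
  rw [hodgeGroupComplexLie_eq_lieSubalgebraGL Φ₂] at h₂ ⊢
  rw [hodgeGroupComplexLie_eq_lieSubalgebraGL (prodPeriod Φ₁ Φ₂)]
  haveI := h₁
  haveI := h₂
  haveI : Module.Finite ℂ (lieSubalgebraGL ((hodgeGroupC (prodPeriod Φ₁ Φ₂)).map Matrix.SpecialLinearGroup.toGL)) :=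
    (isZConnected_map_toGL_hodgeGroupC (prodPeriod Φ₁ Φ₂)).finrank_lieAlgebraGL_eq.1
  haveI : Module.Finite ℂ (lieSubalgebraGL ((hodgeGroupC Φ₁).map Matrix.SpecialLinearGroup.toGL)) :=
    (isZConnected_map_toGL_hodgeGroupC Φ₁).finrank_lieAlgebraGL_eq.1
  haveI : Module.Finite ℂ (lieSubalgebraGL ((hodgeGroupC Φ₂).map Matrix.SpecialLinearGroup.toGL)) :=
    (isZConnected_map_toGL_hodgeGroupC Φ₂).finrank_lieAlgebraGL_eq.1
  obtain ⟨f, g, -, -, hfs, hgs, hker⟩ := exists_lieHom_toBlocks Φ₁ Φ₂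
  obtain ⟨C₁, C₂, hC₁, hC₂, e, -⟩ := GoursatSemisimple.exists_isCompl_and_lieEquiv f g hfs hgs
  obtain ⟨e₁, -⟩ := GoursatSemisimple.exists_lieEquiv_quotient_of_isCompl hC₁
  refine ⟨C₁, C₂, ⟨e⟩, ?_⟩
  rw [e₁.toLinearEquiv.finrank_eq]
  exact GoursatLemma.finrank_add_finrank_quotient_eq f g hfs hgs hker

/-- **Hence `dim 𝔥𝔤_ℂ(X₁ × X₂) = dim 𝔥𝔤_ℂ(X₁) + dim 𝔥𝔤_ℂ(X₂)` UNLESS `𝔥𝔤_ℂ(X₁)`, `𝔥𝔤_ℂ(X₂)` have isomorphic non-zero ideals** ("we may have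
`Hg(X₁ × X₂) ≠ Hg(X₁) × Hg(X₂)`, i.e. `𝔤₃ ≠ 0`"), polarised tori. [cite: MoonenZarhin1999LowDim, §3 (3.1)] -/
theorem IsRiemannForm.finrank_hodgeGroupComplexLie_prod_eq_add_or_exists_lieIdeal {η₁ : E₁ [⋀^Fin 2]→L[ℝ] ℝ}
    {η₂ : E₂ [⋀^Fin 2]→L[ℝ] ℝ} (hη₁ : IsRiemannForm Φ₁ η₁) (hη₂ : IsRiemannForm Φ₂ η₂) :
    finrank ℂ (hodgeGroupComplexLie (prodPeriod Φ₁ Φ₂)) = finrank ℂ (hodgeGroupComplexLie Φ₁) + finrank ℂ (hodgeGroupComplexLie Φ₂) ∨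
      ∃ (C₁ : LieIdeal ℂ (hodgeGroupComplexLie Φ₁)) (C₂ : LieIdeal ℂ (hodgeGroupComplexLie Φ₂)),
        C₁ ≠ ⊥ ∧ Nonempty (C₁ ≃ₗ⁅ℂ⁆ C₂) := by
  obtain ⟨C₁, C₂, hC, hdim⟩ := hη₁.exists_lieIdeal_lieEquiv_finrank_add_eq Φ₁ Φ₂ hη₂
  by_cases h0 : C₁ = ⊥
  · left
    subst h0
    have e : finrank ℂ (⊥ : LieIdeal ℂ (hodgeGroupComplexLie Φ₁)) = finrank ℂ (⊥ : LieIdeal ℂ (hodgeGroupComplexLie Φ₁)).toSubmodule :=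
      rfl
    rw [e, LieSubmodule.bot_toSubmodule, finrank_bot, add_zero] at hdim
    exact hdim
  · exact Or.inr ⟨C₁, C₂, h0, hC⟩

end ComplexTorus

end Literature.Geometry.Kaehler

end
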